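import Mathlib
import Summits.Ventures.HodgeRepro2.LevelPositivity
import Summits.Ventures.HodgeRepro2.LevelSufficientlySmall
import Summits.Ventures.HodgeRepro2.LiuOscillator
import Summits.Ventures.HodgeRepro2.T6B5Data
import Summits.Ventures.HodgeRepro2.T6B5Datum
import Summits.Ventures.HodgeRepro2.T6B5Hyp
import Summits.Ventures.HodgeRepro2.T6B3Hyp
import Summits.Ventures.HodgeRepro2.T6B3Main

/-!
# T6B5Main — Tier 6, sub-goal B5 «single-level positivity + level» in kernel

TIER4 §B5 (Theorem B5.1 (i)–(v), Cor. B5.2, Prop. B5.3(a)) over the representation-level carriers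
`LiuAlbaneseDatum` and the shape `shapeOf` they build:
* `B5_admissibleShape` — THE B3 ↔ B5 CONTRACT: the displayed Def. 4.11 («ω(μ, ε, χ) is an irreducible admissible
  representation») gives p2's `Liu.OscillatorAdmissibleShape` (non-zero `K`-invariants at some small level, for every
  admissible triple) on `shapeOf 𝓛 _ K₀`, for every threshold `K₀` (TIER4 Steps 1–2 for one triple);
* `B5_main` — one level `K` (= `K₀ ∩ Stab(v₁) ∩ ⋯ ∩ Stab(v₄)`, Lemma B5.5(3)) such that every compact open `K' ⊆ K`
  is in the index set (i), has `dim ω(μ_i, ε_i, χ_i)^{K'} ≥ 1` (ii), and `Hom_E(A_{K'}, A_{μ_i})_ℚ ≠ 0` (iv, via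
  t6-p6's displays of Thm. 4.18 over the shape; Remark B5.11(b): no dimension count); monotonicity (iii) is the
  shape's `dimInv_anti`;
* `B5_decomposition` — Cor. B5.2: at every such level the exponent of the orbit of each `μ_i` in Cor. 4.20's
  decomposition (t6-p6's display over the shape) is `≥ 1`;
* `B5_main_neat` — the neat clause of (i) from the author-copy display of Ullmo–Yafaev / Daw;
* `B5_levels` — Prop. B5.3(a): the admissible levels form the accepted `levelsBelow K`;
* `B3_main_of_B5` — the composition with t6-p6's `B3_main` at `S := shape 𝓛 h411 K₀`, the contract binder `hB5`
  discharged by `B5_admissibleShape` (what the lead's T6TheoremA consumes from B3 + B5 together).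
Every published input is consumed BY NAME; the index-set clause of Prop. C.5 is the hypothesis `hIdx` (B2's display).
README §8(d): uses an L-value-free non-vanishing device: NO.
-/

namespace Summit.Ventures.HodgeRepro2.T6.B5Main

open Summit.Ventures.HodgeRepro2.LevelPositivity Summit.Ventures.HodgeRepro2.ShimuraData
  Summit.Ventures.HodgeRepro2.T6.B5Data Summit.Ventures.HodgeRepro2.T6.B5Datum
  Summit.Ventures.HodgeRepro2.T6.Hyp
open Module

universe u

section Generic

variable {G : Type*} [Group G]

/-- An irreducible representation is non-zero (Mathlib's `Representation.IsIrreducible` =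
`IsSimpleOrder (Subrepresentation ρ)`; TIER4 §B5 Step 1(α)). -/
theorem nontrivial_of_isIrreducible {k : Type*} [Field k] {V : Type*} [AddCommGroup V] [Module k V]
    {ρ : Representation k G V} (h : ρ.IsIrreducible) : Nontrivial V := by
  have : IsSimpleModule (MonoidAlgebra k G) ρ.asModule :=
    (Representation.irreducible_iff_isSimpleModule_asModule ρ).mp h
  exact (IsSimpleModule.nontrivial (R := MonoidAlgebra k G) (M := ρ.asModule) : Nontrivial ρ.asModule)

end Generic

variable {K : Type u} [Field K] [NumberField K] [NumberField.IsCMField K] {c : Liu.IdeleConjugation K}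
  {χEF : Liu.QuadraticCharacter K c} (𝓛 : LiuAlbaneseDatum K c χEF)

/-- The finite-dimensionality of the invariants of the oscillator representations, from the displayed Def. 4.11
(Getz–Hahn Def. 5.4, «admissible»). -/
theorem hfd_of (h411 : Liu2021_Def4_11 𝓛) (t : Liu.OscillatorTriple K c χEF) (L : OpenSubgroup 𝓛.G)
    (hL : IsCompact (L : Set 𝓛.G)) : FiniteDimensional ℂ (invariants (𝓛.ω (𝓛.osc t)) (L : Subgroup 𝓛.G)) :=
  (h411 t).2.2 L hL

/-- The shape built from the carriers and the displayed Def. 4.11, with threshold `K₀`. -/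
noncomputable abbrev shape (h411 : Liu2021_Def4_11 𝓛) (K₀ : OpenSubgroup 𝓛.G) : Liu.AlbaneseH1Shape K c χEF :=
  shapeOf 𝓛 (hfd_of 𝓛 h411) K₀

/-- TIER4 Theorem B5.1 Steps 1–2 for one triple = THE B3 ↔ B5 CONTRACT (`B3_main` takes
`hB5 : Liu.OscillatorAdmissibleShape K S`): from the displayed Def. 4.11, every admissible adèlic oscillator triple
has a non-zero vector fixed by a compact open subgroup below any threshold `K₀`, i.e. p2's
`OscillatorAdmissibleShape` holds on `shape 𝓛 h411 K₀`. -/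
theorem B5_admissibleShape (h411 : Liu2021_Def4_11 𝓛) (K₀ : OpenSubgroup 𝓛.G)
    (hK₀ : IsCompact (K₀ : Set 𝓛.G)) : Liu.OscillatorAdmissibleShape K (shape 𝓛 h411 K₀) := by
  intro t _
  obtain ⟨hirr, hsm, hfd⟩ := h411 t
  haveI := nontrivial_of_isIrreducible hirr
  obtain ⟨v, hv⟩ := exists_ne (0 : 𝓛.W (𝓛.osc t))
  let U : OpenSubgroup 𝓛.G := openStabilizer (𝓛.ω (𝓛.osc t)) hsm v
  have hc : IsCompact ((K₀ ⊓ U : OpenSubgroup 𝓛.G) : Set 𝓛.G) := isCompact_inf_of_isCompact_left K₀ U hK₀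
  refine ⟨⟨K₀ ⊓ U, hc⟩, inf_le_left, ?_⟩
  show 0 < finrank ℂ (invariants (𝓛.ω (𝓛.osc t)) ((K₀ ⊓ U : OpenSubgroup 𝓛.G) : Subgroup 𝓛.G))
  haveI := hfd (K₀ ⊓ U) hc
  have hvK : v ∈ invariants (𝓛.ω (𝓛.osc t)) ((K₀ ⊓ U : OpenSubgroup 𝓛.G) : Subgroup 𝓛.G) :=
    mem_invariants_of_le_stabilizer (OpenSubgroup.toSubgroup_le.mpr inf_le_right)
  exact Nat.lt_of_lt_of_le Nat.zero_lt_one (one_le_finrank_invariants _ _ hv hvK)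

/-- The core of TIER4 Theorem B5.1 below a compact open `K₁ ≤ K₀`: the common level `K ≤ K₁` of Lemma B5.5(3) at
which every compact open `K' ≤ K` is in the index set, carries `dim ω_i^{K'} ≥ 1` for the four triples, and has
`Hom_E(A_{K'}, A_{μ_i})_ℚ ≠ 0` (via t6-p6's displays of Thm. 4.18 over the shape). -/
theorem B5_main_of (h411 : Liu2021_Def4_11 𝓛) (K₀ : OpenSubgroup 𝓛.G)
    (hIdx : ∀ L : OpenSubgroup 𝓛.G, IsCompact (L : Set 𝓛.G) → L ≤ K₀ → 𝓛.IsIndex L)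
    (h418i : Liu2021_Thm4_18_iso (shape 𝓛 h411 K₀)) (h4181 : Liu2021_Thm4_18_1 (shape 𝓛 h411 K₀))
    (t : Fin 4 → Liu.OscillatorTriple K c χEF) (ht : ∀ i, Liu.OscillatorTriple.IsAdmissible K (t i))
    (K₁ : OpenSubgroup 𝓛.G) (hK₁ : IsCompact (K₁ : Set 𝓛.G)) (hK₁le : K₁ ≤ K₀) :
    ∃ L : CLevel 𝓛, L.1 ≤ K₁ ∧ ∀ L' : CLevel 𝓛, L' ≤ L →
      𝓛.IsIndex L'.1 ∧
      (∀ i, 0 < (shape 𝓛 h411 K₀).dimInv ((shape 𝓛 h411 K₀).osc (t i)) L') ∧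
      (∀ i, 0 < (shape 𝓛 h411 K₀).homDim L' (t i).μ) ∧
      (∀ i, Nontrivial (𝓛.HomQ L'.1 (t i).μ)) := by
  -- Step 1: non-zero vectors in the four (irreducible) representations.
  have hnt : ∀ i, Nontrivial (𝓛.W (𝓛.osc (t i))) := fun i => nontrivial_of_isIrreducible (h411 (t i)).1
  choose v hv using fun i => @exists_ne _ (hnt i) (0 : 𝓛.W (𝓛.osc (t i)))
  -- Step 2: the common level (Lemma B5.5(3)).
  obtain ⟨Kc, hKc, hKle, hKv⟩ := exists_common_level (k := ℂ) (fun i => 𝓛.W (𝓛.osc (t i)))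
    (fun i => 𝓛.ω (𝓛.osc (t i))) (fun i => (h411 (t i)).2.1) v K₁ hK₁
  refine ⟨⟨Kc, hKc⟩, hKle, ?_⟩
  rintro ⟨L', hL'c⟩ hle
  have hle' : L' ≤ Kc := hle
  have hsmall : L' ≤ K₀ := hle'.trans (hKle.trans hK₁le)
  have hpos : ∀ i, 0 < (shape 𝓛 h411 K₀).dimInv ((shape 𝓛 h411 K₀).osc (t i)) ⟨L', hL'c⟩ := by
    intro i
    show 0 < finrank ℂ (invariants (𝓛.ω (𝓛.osc (t i))) (L' : Subgroup 𝓛.G))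
    haveI := hfd_of 𝓛 h411 (t i) L' hL'c
    exact Nat.lt_of_lt_of_le Nat.zero_lt_one
      (one_le_finrank_invariants _ _ (hv i) (hKv (L' : Subgroup 𝓛.G) (OpenSubgroup.toSubgroup_le.mpr hle') i))
  have hhom : ∀ i, 0 < (shape 𝓛 h411 K₀).homDim ⟨L', hL'c⟩ (t i).μ := by
    intro i
    have h1 := h418i (t i) (ht i) ⟨L', hL'c⟩ hsmall
    have h2 := h4181 (t i).μ (Liu.OscillatorTriple.isWeightOneConjugateSymplectic K (ht i)) ⟨L', hL'c⟩ hsmall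
    exact h2 ▸ (lt_of_lt_of_le (hpos i) h1)
  refine ⟨hIdx L' hL'c hsmall, hpos, hhom, fun i => ?_⟩
  exact Module.nontrivial_of_finrank_pos (R := ℚ) (hhom i)

/-- TIER4 Theorem B5.1 (i), (ii), (iv) + Lemma B5.5(3): ONE compact open level `K ≤ K₀` such that every compact open
`K' ≤ K` is in the index set, carries `dim ω(μ_i, ε_i, χ_i)^{K'} ≥ 1` for `i = 1..4`, and has
`Hom_E(A_{K'}, A_{μ_i})_ℚ ≠ 0`; (iii) (monotonicity) is the shape's `dimInv_anti`. Inputs: the displayed Def. 4.11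
(B5), the index-set clause of Prop. C.5 below the threshold `K₀` (B2's display, reading (SS)), t6-p6's displays of
Thm. 4.18 over the shape, and the four admissible triples of B3 (`B3_triples`). -/
theorem B5_main (h411 : Liu2021_Def4_11 𝓛) (K₀ : OpenSubgroup 𝓛.G) (hK₀ : IsCompact (K₀ : Set 𝓛.G))
    (hIdx : ∀ L : OpenSubgroup 𝓛.G, IsCompact (L : Set 𝓛.G) → L ≤ K₀ → 𝓛.IsIndex L)
    (h418i : Liu2021_Thm4_18_iso (shape 𝓛 h411 K₀)) (h4181 : Liu2021_Thm4_18_1 (shape 𝓛 h411 K₀))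
    (t : Fin 4 → Liu.OscillatorTriple K c χEF) (ht : ∀ i, Liu.OscillatorTriple.IsAdmissible K (t i)) :
    ∃ L : CLevel 𝓛, (shape 𝓛 h411 K₀).IsSmall L ∧ ∀ L' : CLevel 𝓛, L' ≤ L →
      𝓛.IsIndex L'.1 ∧
      (∀ i, 0 < (shape 𝓛 h411 K₀).dimInv ((shape 𝓛 h411 K₀).osc (t i)) L') ∧
      (∀ i, 0 < (shape 𝓛 h411 K₀).homDim L' (t i).μ) ∧
      (∀ i, Nontrivial (𝓛.HomQ L'.1 (t i).μ)) :=
  B5_main_of 𝓛 h411 K₀ hIdx h418i h4181 t ht K₀ hK₀ le_rfl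

/-- TIER4 Theorem B5.1(i), neat clause (Lemma B5.8 (N2)): with the author-copy display of Ullmo–Yafaev / Daw the
level of `B5_main` can be taken below a neat compact open subgroup of `K₀`, and then every compact open `K' ≤ K` is
neat (the elementwise (N1), `Elementwise.mono`). -/
theorem B5_main_neat (h411 : Liu2021_Def4_11 𝓛) (K₀ : OpenSubgroup 𝓛.G) (hK₀ : IsCompact (K₀ : Set 𝓛.G))
    (hIdx : ∀ L : OpenSubgroup 𝓛.G, IsCompact (L : Set 𝓛.G) → L ≤ K₀ → 𝓛.IsIndex L)
    (h418i : Liu2021_Thm4_18_iso (shape 𝓛 h411 K₀)) (h4181 : Liu2021_Thm4_18_1 (shape 𝓛 h411 K₀))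
    (hUY : UllmoYafaev2014_neatInside 𝓛)
    (t : Fin 4 → Liu.OscillatorTriple K c χEF) (ht : ∀ i, Liu.OscillatorTriple.IsAdmissible K (t i)) :
    ∃ L : CLevel 𝓛, (shape 𝓛 h411 K₀).IsSmall L ∧ ∀ L' : CLevel 𝓛, L' ≤ L →
      Elementwise 𝓛.neat (L'.1 : Subgroup 𝓛.G) ∧
      𝓛.IsIndex L'.1 ∧
      (∀ i, 0 < (shape 𝓛 h411 K₀).dimInv ((shape 𝓛 h411 K₀).osc (t i)) L') ∧
      (∀ i, 0 < (shape 𝓛 h411 K₀).homDim L' (t i).μ) ∧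
      (∀ i, Nontrivial (𝓛.HomQ L'.1 (t i).μ)) := by
  obtain ⟨K₁, hK₁, hK₁le, -, hneat⟩ := hUY K₀ hK₀
  obtain ⟨L, hL, h⟩ := B5_main_of 𝓛 h411 K₀ hIdx h418i h4181 t ht K₁ hK₁ hK₁le
  refine ⟨L, hL.trans hK₁le, fun L' hle => ⟨?_, h L' hle⟩⟩
  exact Elementwise.mono hneat (OpenSubgroup.toSubgroup_le.mpr ((show L'.1 ≤ L.1 from hle).trans hL))

/-- TIER4 Corollary B5.2 (the exponents of Cor. 4.20 at the level): at every level `L ≤ K₀` where the four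
oscillator representations have non-zero invariants, t6-p6's display of Cor. 4.20 over the shape gives the
decomposition `A_L ∼ ∏_μ A_μ^{d(μ,L)}` with representatives `reps` and index sets `T`, and the exponent
`d(μ_i, L) = liuMultiplicity (T μ_i) L` of each `μ_i` is `≥ 1` (`dimInv_le_liuMultiplicity`). -/
theorem B5_decomposition (h411 : Liu2021_Def4_11 𝓛) (K₀ : OpenSubgroup 𝓛.G)
    (h420 : Liu2021_Cor4_20 (shape 𝓛 h411 K₀)) (hn : 3 ≤ 𝓛.n)
    (t : Fin 4 → Liu.OscillatorTriple K c χEF) (ht : ∀ i, Liu.OscillatorTriple.IsAdmissible K (t i))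
    (L : CLevel 𝓛) (hL : (shape 𝓛 h411 K₀).IsSmall L)
    (hpos : ∀ i, 0 < (shape 𝓛 h411 K₀).dimInv ((shape 𝓛 h411 K₀).osc (t i)) L) :
    ∃ (reps : Finset (Liu.AutomorphicCharacter K)) (T : Liu.AutomorphicCharacter K →
        Finset (Liu.OscillatorTriple K c χEF)),
      (∀ μ ∈ reps, Liu.IsWeightOneConjugateSymplectic K c χEF μ) ∧
      (∀ μ, ∀ t' ∈ T μ, t'.μ = μ ∧ Liu.OscillatorTriple.IsAdmissible K t') ∧
      (∀ μ ∈ reps, ∀ μ' ∈ reps, (shape 𝓛 h411 K₀).galOrbit μ μ' → μ = μ') ∧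
      (shape 𝓛 h411 K₀).albanese L =
        ∏ μ ∈ reps, (shape 𝓛 h411 K₀).cmVariety μ ^ Liu.liuMultiplicity K (shape 𝓛 h411 K₀) (T μ) L ∧
      ∀ i, 0 < Liu.liuMultiplicity K (shape 𝓛 h411 K₀) (T (t i).μ) L := by
  obtain ⟨reps, T, h1, h2, h3, h4, -, h6⟩ := h420 hn L hL
  refine ⟨reps, T, h1, h2, h4, h6, fun i => ?_⟩
  obtain ⟨t', ht'T, ht'⟩ := Finset.mem_image.mp (h3 (t i).μ (t i) (ht i) rfl (hpos i))
  have := Liu.dimInv_le_liuMultiplicity K (shape 𝓛 h411 K₀) ht'T L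
  rw [ht'] at this
  exact lt_of_lt_of_le (hpos i) this

/-- TIER4 Proposition B5.3(a): the admissible levels below the level `K` of `B5_main` form the accepted
`levelsBelow K` (non-empty, closed under intersection with open subgroups, downward closed), and every member
satisfies the conclusion (the conclusion of `B5_main` is stated for every `L' ≤ L`). -/
theorem B5_levels {L : CLevel 𝓛} {P : CLevel 𝓛 → Prop} (h : ∀ L' : CLevel 𝓛, L' ≤ L → P L') :
    ∀ L' ∈ levelsBelow L.1, ∀ hL' : IsCompact (L' : Set 𝓛.G), P ⟨L', hL'⟩ := fun L' hL' hL'c =>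
  h ⟨L', hL'c⟩ (mem_levelsBelow.mp hL').2

/-- THEOREM B3 (t6-p6's `B3_main`) at the shape built from B5's carriers, with the B3 ↔ B5 contract binder
`hB5 : Liu.OscillatorAdmissibleShape K S` DISCHARGED by `B5_admissibleShape`: from the displayed Def. 4.11 (B5) and
t6-p6's displays (DR15 Lemma 3.5, Liu Prop. 4.13, Thm. 4.18 (two clauses), Cor. 4.20) at `S = shape 𝓛 h411 K₀`, the
four-vertex datum `D` of B3 exists with all of THEOREM B3's clauses, including the common level with
`Hom_E(A_L, A_{μ_i})_ℚ ≠ 0` and the exponents `≥ 1` in Cor. 4.20's decomposition. -/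
theorem B3_main_of_B5 [IsGalois ℚ K] (h411 : Liu2021_Def4_11 𝓛) (K₀ : OpenSubgroup 𝓛.G)
    (hK₀ : IsCompact (K₀ : Set 𝓛.G)) (hn : 3 ≤ 𝓛.n)
    (hDR : DimitrovRamakrishnan2015_Lemma3_5 K c χEF) (h413 : Liu2021_Prop4_13 (shape 𝓛 h411 K₀))
    (h418i : Liu2021_Thm4_18_iso (shape 𝓛 h411 K₀)) (h4181 : Liu2021_Thm4_18_1 (shape 𝓛 h411 K₀))
    (h420 : Liu2021_Cor4_20 (shape 𝓛 h411 K₀))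
    (τ₀ : K →+* ℂ) (T : Fin 4 → Set (K →+* ℂ)) (hT : Summit.Ventures.HodgeRepro2.IsWeilFace K T)
    (χ : Liu.OneCharacter K c) :
    ∃ D : Liu.FaceOscillatorData K c χEF τ₀ T,
      (∀ i, (D.vertex i).χ = χ) ∧
      (∀ i, Liu.OscillatorTriple.IsAdmissible K (D.vertex i)) ∧
      (∀ i, Liu.IsWeightOneConjugateSymplectic K c χEF (D.vertex i).μ) ∧
      (Summit.Ventures.HodgeRepro2.IsWeilFace K fun i => Summit.Ventures.HodgeRepro2.inverseType K τ₀ (T i)) ∧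
      (∀ i, Summit.Ventures.HodgeRepro2.ShimuraData.cmTypeOfImaginary K (D.vertex i).e =
        Summit.Ventures.HodgeRepro2.inverseType K τ₀ (T i)) ∧
      (∀ (τ' : K →+* ℂ) i, (shape 𝓛 h411 K₀).mult τ' ((shape 𝓛 h411 K₀).osc (D.vertex i)) = 1) ∧
      (∀ (τ' : K →+* ℂ) i,
        (shape 𝓛 h411 K₀).mult τ' ((shape 𝓛 h411 K₀).osc (Liu.OscillatorTriple.conj K (D.vertex i))) = 1) ∧
      ∃ L, (shape 𝓛 h411 K₀).IsSmall L ∧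
        (∀ i, 0 < (shape 𝓛 h411 K₀).dimInv ((shape 𝓛 h411 K₀).osc (D.vertex i)) L) ∧
        (∀ i, 1 ≤ (shape 𝓛 h411 K₀).omegaInvDim L (D.vertex i).μ) ∧
        (∀ i, 1 ≤ (shape 𝓛 h411 K₀).homDim L (D.vertex i).μ) ∧
        ∃ (reps : Finset (Liu.AutomorphicCharacter K))
          (Tf : Liu.AutomorphicCharacter K → Finset (Liu.OscillatorTriple K c χEF)),
          (∀ μ ∈ reps, Liu.IsWeightOneConjugateSymplectic K c χEF μ) ∧
          (∀ μ ∈ reps, ∀ μ' ∈ reps, (shape 𝓛 h411 K₀).galOrbit μ μ' → μ = μ') ∧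
          (shape 𝓛 h411 K₀).albanese L =
            ∏ μ ∈ reps, (shape 𝓛 h411 K₀).cmVariety μ ^ Liu.liuMultiplicity K (shape 𝓛 h411 K₀) (Tf μ) L ∧
          (∀ i, 1 ≤ Liu.liuMultiplicity K (shape 𝓛 h411 K₀) (Tf (D.vertex i).μ) L) ∧
          ∀ i, ∃ μ' ∈ reps, (shape 𝓛 h411 K₀).galOrbit (D.vertex i).μ μ' :=
  B3_main K c χEF (shape 𝓛 h411 K₀) hn hDR h413 h418i h4181 h420 (B5_admissibleShape 𝓛 h411 K₀ hK₀) τ₀ T hT χ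

end Summit.Ventures.HodgeRepro2.T6.B5Main
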